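import Summits.Parity.GeneralizedHardyLittlewood.Theorems.MaynardProductExactDenUB3750

/-! # Route `MaynardProductExact` — crux `DenUB3750` (stmt-Parity-19251): the registered stub BY NAME

Stub-credit record for the single registered stub `stub_denHoeffdingCert` of the line
`Cruxes/DenUB3750/Lines/birth.lean` (skeleton 8998084395200d2e).  The stub was PROVED (signature verbatim) inside the accepted closer
`Theorems/MaynardProductExactDenUB3750.lean` as
`Summit.Parity.GeneralizedHardyLittlewood.MaynardProductExactDenUB3750.stub_denHoeffdingCert` (the `k = 3750` kernel certificate,
`ProductKernelCert3750.stub_of_factsD` on the facts `okD okQ0–okQ2 okS`), and the crux itself is closed by `denUB3750_proof` of that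
file.  This file only re-exports that theorem under the stub's registered name as a `--supports` landing, so that the ledger's stub
record is credited by name; it proves nothing new.  Rung F-P1.R4 bookkeeping; no summit is proved here. -/

noncomputable section

open MeasureTheory Set Finset
open Literature.Analysis.Convolution Literature.NumberTheory.Sieve Literature.NumberTheory.Sieve.MaynardTao

namespace Summit.Parity.GeneralizedHardyLittlewood.MaynardProductExactDenUB3750Stub

/-- **The registered stub `stub_denHoeffdingCert` of crux `DenUB3750`** (signature verbatim): some lattice `h > 0` with
`J_c h > 3/4`, a cut `m⋆` and a tail parameter `λ ≥ 0` with `(1 − (m⋆+1)h) + λ ≤ 3750·(∫ r_h g²)/m₂` and the finite inequality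
`Σ_{m ≤ m⋆} (p^{∗3750})_m + m₂^{3750} e^{−2λ²/(3750 h²)} ≤ 0.41694 · m₂^{3750}`
(`g = polymathProfile 3750 (249/2000) (3/4)`, `p = cellMass g² h`, `m₂ = 10⁶/466771167`).  Proof: the accepted theorem
`MaynardProductExactDenUB3750.stub_denHoeffdingCert` (kernel certificate). -/
theorem stub_denHoeffdingCert :
    ∃ (h : ℝ) (Jc mstar : ℕ) (lam : ℝ), 0 < h ∧ (3 : ℝ) / 4 < (Jc : ℝ) * h ∧ 0 ≤ lam ∧
      (1 - ((mstar : ℝ) + 1) * h) + lam ≤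
        (3750 : ℝ) * ((∫ x in Ici 0, roundErr h x * polymathProfile 3750 ((249 : ℝ) / 2000) ((3 : ℝ) / 4) x ^ 2) /
          ((1000000 : ℝ) / 466771167)) ∧
      ∑ m ∈ range (mstar + 1),
          dconvPow (cellMass (fun t => polymathProfile 3750 ((249 : ℝ) / 2000) ((3 : ℝ) / 4) t ^ 2) h) 3750 m +
        ((1000000 : ℝ) / 466771167) ^ 3750 * Real.exp (-2 * lam ^ 2 / ((3750 : ℝ) * h ^ 2)) ≤
        (41694 : ℝ) / 100000 * ((1000000 : ℝ) / 466771167) ^ 3750 :=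
  MaynardProductExactDenUB3750.stub_denHoeffdingCert

end Summit.Parity.GeneralizedHardyLittlewood.MaynardProductExactDenUB3750Stub

end
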